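import Mathlib
import Summits.Ventures.PercRepro2.Defs
import Summits.Ventures.PercRepro2.Independence
import Summits.Ventures.PercRepro2.Harris

/-!
# The cube step of `(ZC-direct)` (blind cell PercRepro2, mine-a g29)

Abstract product-space statement behind MINE-A.md §83.1 (2)–(3).  On a finite product space with an
increasing `[0,1]`-valued observable `u` and increasing events `X`, `W` that are INDEPENDENT
(`P(X ∩ W) = P(X) P(W)`): for every `S ≥ 0` and every `b`,

  `S·(E[u 1_{X∩W}] − E[u] P(X∩W)) − b·(E[u 1_X] − E[u] P(X)) ≥ (S·P(W) − b)·(E[u 1_X] − E[u] P(X))`,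

because the difference is `S·(E[(u 1_X) 1_W] − E[u 1_X] P(W)) ≥ 0` by Harris (`u 1_X` and `1_W` are
increasing).  The "influence" form of the covariance with an event `X` whose complement is the
intersection of closed edges of a set `C`: `E[u 1_X] − E[u] P(X) = P(Xᶜ)·(E[u] − E[u ∘ clear_C])`.
-/

namespace Summit.Ventures.PercRepro2

namespace ZCDirect

variable {E : Type*} [Fintype E] [DecidableEq E] {R : Type*} [CommRing R] [LinearOrder R]
  [IsStrictOrderedRing R]

omit [Fintype E] [DecidableEq E] in
/-- `u · 1_X` is monotone when `u ≥ 0` is monotone and `X` is an up-set. -/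
lemma monotone_mul_indicator {u : Config E → R} (hu : Monotone u) (hu0 : ∀ ω, 0 ≤ u ω)
    {X : Set (Config E)} (hX : IsUpperSet X) :
    Monotone (fun ω => u ω * X.indicator 1 ω) := by
  intro ω ω' h
  have h1 := monotone_indicator_of_isUpperSet (R := R) hX h
  have h0 : (0 : R) ≤ X.indicator 1 ω := Set.indicator_nonneg (fun _ _ => zero_le_one) ω
  calc u ω * X.indicator 1 ω ≤ u ω' * X.indicator 1 ω := mul_le_mul_of_nonneg_right (hu h) h0
    _ ≤ u ω' * X.indicator 1 ω' := mul_le_mul_of_nonneg_left h1 (hu0 ω')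

/-- Harris for `u 1_X` against an increasing event `W`: `E[u 1_X] P(W) ≤ E[u 1_{X ∩ W}]`. -/
lemma expect_mul_indicator_mul_prob_le {p : E → R} (hp : IsProbVec p) {u : Config E → R}
    (hu : Monotone u) (hu0 : ∀ ω, 0 ≤ u ω) {X W : Set (Config E)} (hX : IsUpperSet X)
    (hW : IsUpperSet W) :
    expect p (fun ω => u ω * X.indicator 1 ω) * prob p W ≤
      expect p (fun ω => u ω * (X ∩ W).indicator 1 ω) := by
  rw [prob_eq_expect_indicator]
  have h := expect_mul_expect_le_expect_mul hp (monotone_mul_indicator hu hu0 hX)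
    (monotone_indicator_of_isUpperSet (R := R) hW)
  refine h.trans (le_of_eq ?_)
  unfold expect
  refine Finset.sum_congr rfl fun ω _ => ?_
  rw [Pi.mul_apply, mul_assoc, ← indicator_inter_one]

/-- **The cube step.** For independent increasing events `X`, `W` and an increasing `u ≥ 0`:
`S·Cov(u, 1_{X∩W}) − b·Cov(u, 1_X) ≥ (S·P(W) − b)·Cov(u, 1_X)` whenever `S ≥ 0`. -/
theorem cube_step {p : E → R} (hp : IsProbVec p) {u : Config E → R} (hu : Monotone u)
    (hu0 : ∀ ω, 0 ≤ u ω) {X W : Set (Config E)} (hX : IsUpperSet X) (hW : IsUpperSet W)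
    (hind : prob p (X ∩ W) = prob p X * prob p W) {S b : R} (hS : 0 ≤ S) :
    (S * prob p W - b) * (expect p (fun ω => u ω * X.indicator 1 ω) - expect p u * prob p X) ≤
      S * (expect p (fun ω => u ω * (X ∩ W).indicator 1 ω) - expect p u * prob p (X ∩ W)) -
        b * (expect p (fun ω => u ω * X.indicator 1 ω) - expect p u * prob p X) := by
  have h := expect_mul_indicator_mul_prob_le hp hu hu0 hX hW
  have h2 : 0 ≤ S * (expect p (fun ω => u ω * (X ∩ W).indicator 1 ω) -
      expect p (fun ω => u ω * X.indicator 1 ω) * prob p W) :=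
    mul_nonneg hS (sub_nonneg.2 h)
  rw [hind]
  nlinarith [h2]

/-- The influence form of the covariance with an event `X` such that `Xᶜ` is an event of the edges
of a set `C` on which `u` restricted to `Xᶜ` coincides with `u ∘ clear`, `clear` closing the edges
of `C`: stated abstractly as the identity `E[u 1_{Xᶜ}] = P(Xᶜ) · E[u ∘ clear]` given
`P({clear ω ∈ ·} ∩ Xᶜ) = P({clear ω ∈ ·}) P(Xᶜ)`-type independence.  We only record the algebra:
`E[u 1_X] − E[u] P(X) = P(Xᶜ) · (E[u] − E[u ∘ clear])` follows from
`E[u 1_{Xᶜ}] = P(Xᶜ) · E[u ∘ clear]`. -/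
lemma cov_eq_of_compl_factor {p : E → R} {u : Config E → R} {X : Set (Config E)} {c : R}
    (h : expect p (fun ω => u ω * Xᶜ.indicator 1 ω) = prob p Xᶜ * c) :
    expect p (fun ω => u ω * X.indicator 1 ω) - expect p u * prob p X =
      prob p Xᶜ * (expect p u - c) := by
  have hsplit : expect p u = expect p (fun ω => u ω * X.indicator 1 ω) +
      expect p (fun ω => u ω * Xᶜ.indicator 1 ω) := by
    rw [← expect_add]
    unfold expect
    refine Finset.sum_congr rfl fun ω _ => ?_
    by_cases hω : ω ∈ X
    · have : ω ∉ Xᶜ := fun h' => h' hω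
      simp [hω, this]
    · have : ω ∈ Xᶜ := hω
      simp [hω, this]
  have hc := prob_compl p X
  rw [hc] at h ⊢
  linear_combination -hsplit - h

end ZCDirect

end Summit.Ventures.PercRepro2
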